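import Literature.Probability.RandomPlanarGeometry.RestrictionDerivTime
import Literature.Probability.RandomPlanarGeometry.LoewnerAdaptedPlane
import Literature.Probability.RandomPlanarGeometry.LoewnerHullHitting
import HarnessLib

/-!
# The event "the Loewner hulls have not reached `A`" is measurable ([LSW] §5, `t < T_A`)

For a family of continuous driving functions `W ω : ℝ≥0 → ℝ` with `W ω 0 = 0`
(`ω ∈ (Ω, 𝓜)`, `ω ↦ W ω s` measurable for `s ≤ t`; think `𝓜 = 𝓕ᵂ_t`, `W ω = √κ B(ω)`) and a
nonempty `*`-hull `A`, we give a **countable description of the alive event**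

  `{ω | Disjoint (closedHull (W ω) t) A}`   (all points of `A`, real ones included, still flowing)

in terms of the flows of countably many points of `A ∩ ℍ`: with `(a_k)` dense in `A ∩ ℍ` (dense
in `A`, as `A = closure (A ∩ ℍ)`) and the clipped distances

  `ψ_{k,q}(ω) = min ‖g_q(a_k) - W_q‖ 1` if `q < T_{a_k}`, `1` otherwise,

the alive event is `{0 < aliveFn}`, `aliveFn = inf_{k, q ∈ (ℚ ∩ [0,t]) ∪ {t}} ψ_{k,q}`
(`disjoint_closedHull_iff_aliveFn_pos`). Indeed, if all of `A` is alive up to `t`, then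
`s ↦ dist(W_s, g_s(A))` is continuous and positive on `[0, t]` (`RestrictionDerivTime`), bounding
every `ψ` from below; if some `a* ∈ A` (possibly real) is swallowed at `τ ≤ t`, then by the
extension criterion its flow comes `ε`-close to the driver at some `s < τ`, and so does the flow
of a nearby `a_k` at a nearby rational time (continuity of `z ↦ g_s(z)` at the alive point `a*`,
continuity in time). Consequently the alive event is `𝓜`-measurable
(`measurableSet_disjoint_closedHull`; `LoewnerAdaptedPlane` supplies the measurability of the
flows and lifetimes of the points `a_k ∈ ℍ`).

## References

* G. F. Lawler, O. Schramm, W. Werner, *Conformal restriction: the chordal case* (2003), §5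
  (`T = inf{t : K_t ∩ A ≠ ∅}`) [LawlerSchrammWerner2003Restriction].
* S. Rohde, O. Schramm, *Basic properties of SLE* (2005), §3 p. 896 (measurability in
  `σ(ξ(s), s ≤ t)`).
-/

noncomputable section

open Set Filter Metric Function MeasureTheory
open _root_.Complex _root_.Topology
open UpperHalfPlane (upperHalfPlaneSet)
open scoped NNReal

namespace Literature.Probability.RandomPlanarGeometry

namespace Loewner

/-! ### A dense sequence in `A ∩ ℍ` -/

/-- A nonempty `*`-hull contains a sequence of points of `ℍ` dense in it (`A = closure (A ∩ ℍ)`).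
[folklore] -/
theorem exists_denseSeq {A : Set ℂ} (hA : IsStarHull A) (hne : A.Nonempty) :
    ∃ a : ℕ → ℂ, (∀ k, a k ∈ A ∧ 0 < (a k).im) ∧ A ⊆ closure (range a) := by
  have hcl : closure (A ∩ upperHalfPlaneSet) = A := hA.isBoundedHull.2.1
  have hne' : (A ∩ upperHalfPlaneSet).Nonempty := by
    by_contra h
    rw [not_nonempty_iff_eq_empty] at h
    rw [h, closure_empty] at hcl
    exact hne.ne_empty hcl.symm
  obtain ⟨t, hts, htc, hdense⟩ :=
    (TopologicalSpace.IsSeparable.of_separableSpace (A ∩ upperHalfPlaneSet)).exists_countable_dense_subset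
  have htne : t.Nonempty := by
    by_contra h
    rw [not_nonempty_iff_eq_empty] at h
    rw [h, closure_empty] at hdense
    exact hne'.ne_empty (subset_empty_iff.1 hdense)
  obtain ⟨a, rfl⟩ := htc.exists_eq_range htne
  refine ⟨a, fun k ↦ ?_, ?_⟩
  · exact ⟨(hts ⟨k, rfl⟩).1, (hts ⟨k, rfl⟩).2⟩
  · rw [← hcl]; exact closure_minimal hdense isClosed_closure

/-! ### The clipped distances and the alive functional -/

section AliveFn

variable {Ω : Type*} {W : Ω → ℝ≥0 → ℝ} {A : Set ℂ} {t : ℝ≥0} (a : ℕ → ℂ)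

open Classical in
/-- The clipped distance `ψ_{k,q} = min ‖g_q(a_k) - W_q‖ 1` of the flow of `a_k` from the driver
at time `q` (`1` if `a_k` is already swallowed). [folklore] -/
def clipDist (W : Ω → ℝ≥0 → ℝ) (k : ℕ) (q : ℝ≥0) (ω : Ω) : ℝ :=
  if (q : WithTop ℝ≥0) < swallowingTime (W ω) (a k) then min ‖map (W ω) q (a k) - W ω q‖ 1 else 1

/-- `0 ≤ ψ ≤ 1`. [folklore] -/
theorem clipDist_mem_Icc (W : Ω → ℝ≥0 → ℝ) (k : ℕ) (q : ℝ≥0) (ω : Ω) : clipDist a W k q ω ∈ Icc (0 : ℝ) 1 := by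
  rw [clipDist]
  split_ifs
  · exact ⟨le_min (norm_nonneg _) zero_le_one, min_le_right _ _⟩
  · exact ⟨zero_le_one, le_rfl⟩

/-- The rational times of `[0, t]`. [folklore] -/
def ratTimes (t : ℝ≥0) : Type := {q : ℚ // 0 ≤ (q : ℝ) ∧ (q : ℝ) ≤ t}

/-- The rational times are countable. [folklore] -/
instance (t : ℝ≥0) : Countable (ratTimes t) := Subtype.countable

/-- `0` is a rational time. [folklore] -/
instance (t : ℝ≥0) : Nonempty (ratTimes t) := ⟨⟨0, by simp⟩⟩

/-- A rational time as a point of `ℝ≥0`. [folklore] -/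
def ratTimes.val {t : ℝ≥0} (q : ratTimes t) : ℝ≥0 := ⟨(q.1 : ℝ), q.2.1⟩

/-- Rational times are `≤ t`. [folklore] -/
theorem ratTimes.val_le {t : ℝ≥0} (q : ratTimes t) : q.val ≤ t := by
  change ((q.1 : ℝ)) ≤ t at *; exact_mod_cast q.2.2

/-- **The alive functional** `aliveFn = min (inf_{k, q ∈ ℚ ∩ [0,t]} ψ_{k,q}) (inf_k ψ_{k,t}) ∈ [0, 1]`.
[folklore] -/
def aliveFn (W : Ω → ℝ≥0 → ℝ) (t : ℝ≥0) (ω : Ω) : ℝ :=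
  min (⨅ p : ℕ × ratTimes t, clipDist a W p.1 p.2.val ω) (⨅ k : ℕ, clipDist a W k t ω)

/-- `0 ≤ aliveFn`. [folklore] -/
theorem aliveFn_nonneg (W : Ω → ℝ≥0 → ℝ) (t : ℝ≥0) (ω : Ω) : 0 ≤ aliveFn a W t ω :=
  le_min (le_ciInf fun _ ↦ (clipDist_mem_Icc a W _ _ ω).1) (le_ciInf fun _ ↦ (clipDist_mem_Icc a W _ _ ω).1)

/-- `aliveFn ≤ ψ_{k,q}` at rational times. [folklore] -/
theorem aliveFn_le_clipDist_rat (W : Ω → ℝ≥0 → ℝ) {t : ℝ≥0} (ω : Ω) (k : ℕ) (q : ratTimes t) :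
    aliveFn a W t ω ≤ clipDist a W k q.val ω :=
  (min_le_left _ _).trans (ciInf_le ⟨0, by rintro _ ⟨p, rfl⟩; exact (clipDist_mem_Icc a W _ _ ω).1⟩ (k, q))

/-- `aliveFn ≤ ψ_{k,t}`. [folklore] -/
theorem aliveFn_le_clipDist_self (W : Ω → ℝ≥0 → ℝ) (t : ℝ≥0) (ω : Ω) (k : ℕ) :
    aliveFn a W t ω ≤ clipDist a W k t ω :=
  (min_le_right _ _).trans (ciInf_le ⟨0, by rintro _ ⟨p, rfl⟩; exact (clipDist_mem_Icc a W _ _ ω).1⟩ k)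

/-- A uniform lower bound on the `ψ`'s at the times `≤ t` bounds `aliveFn` from below. [folklore] -/
theorem le_aliveFn (W : Ω → ℝ≥0 → ℝ) {t : ℝ≥0} (ω : Ω) {c : ℝ}
    (h : ∀ k (q : ℝ≥0), q ≤ t → c ≤ clipDist a W k q ω) : c ≤ aliveFn a W t ω :=
  le_min (le_ciInf fun p ↦ h p.1 _ (ratTimes.val_le p.2)) (le_ciInf fun k ↦ h k t le_rfl)

end AliveFn

/-! ### Measurability -/

section Measurable

variable {Ω : Type*} {mΩ : MeasurableSpace Ω} {W : Ω → ℝ≥0 → ℝ} {t : ℝ≥0} {a : ℕ → ℂ}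

/-- Each clipped distance at a time `q ≤ t` is measurable (flows and lifetimes of points of `ℍ` are
measurable functionals of the path up to time `q ≤ t`, `LoewnerAdaptedPlane`). [folklore] -/
theorem measurable_clipDist (hc : ∀ ω, Continuous (W ω)) (hmeas : ∀ s, s ≤ t → Measurable fun ω ↦ W ω s)
    (ha : ∀ k, 0 < (a k).im) (k : ℕ) {q : ℝ≥0} (hq : q ≤ t) : Measurable (clipDist a W k q) := by
  classical
  have hmeas' : ∀ s, s ≤ q → Measurable fun ω ↦ W ω s := fun s hs ↦ hmeas s (hs.trans hq)
  have hE := measurableSet_lt_swallowingTime_of_im_pos (t := q) hc hmeas' (ha k)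
  have hmap := measurable_map_of_im_pos (t := q) hc hmeas' (ha k)
  have hW := hmeas q hq
  refine Measurable.ite hE ?_ measurable_const
  exact ((hmap.sub (Complex.measurable_ofReal.comp hW)).norm).min measurable_const

/-- **`aliveFn` is measurable** (countable infimum). [folklore] -/
theorem measurable_aliveFn (hc : ∀ ω, Continuous (W ω)) (hmeas : ∀ s, s ≤ t → Measurable fun ω ↦ W ω s)
    (ha : ∀ k, 0 < (a k).im) : Measurable (aliveFn a W t) := by
  refine Measurable.min ?_ ?_
  · exact Measurable.iInf fun p ↦ measurable_clipDist hc hmeas ha p.1 (ratTimes.val_le p.2)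
  · exact Measurable.iInf fun k ↦ measurable_clipDist hc hmeas ha k le_rfl

end Measurable


/-! ### The alive event is `{0 < aliveFn}` -/

section AliveIff

variable {Ω : Type*} {W : Ω → ℝ≥0 → ℝ} {A : Set ℂ} {t : ℝ≥0} {a : ℕ → ℂ}

/-- **Alive ⇒ `aliveFn > 0`**: if the closed hulls miss `A` at time `t`, then
`s ↦ dist(W_s, g_s(A))` is continuous and positive on `[0, t]`, so every clipped distance of a
point of `A` at a time `≤ t` is at least `min (min_s dist) 1 > 0`. [folklore] -/
theorem aliveFn_pos_of_disjoint {ω : Ω} (hW : Continuous (W ω)) (hA : IsStarHull A) (hne : A.Nonempty)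
    (ha : ∀ k, a k ∈ A) (ht : Disjoint (closedHull (W ω) t) A) : 0 < aliveFn a W t ω := by
  set m : ℝ≥0 → ℝ := fun s ↦ infDist 0 (slidHull (W ω) A s) with hm
  have halive : ∀ s ∈ Icc (0 : ℝ≥0) t, Disjoint (closedHull (W ω) s) A := fun s hs ↦ alive_mono hs.2 ht
  have hcont : ContinuousOn m (Icc 0 t) := fun s hs ↦
    (continuousWithinAt_infDist_slidHull hW hA hne (halive s hs)).mono fun s' hs' ↦ halive s' hs'
  obtain ⟨s₀, hs₀, hmin⟩ := isCompact_Icc.exists_isMinOn ⟨0, left_mem_Icc.2 bot_le⟩ hcont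
  have hμ : 0 < m s₀ := (infDist_zero_pos (isStarHull_slidHull_of_disjoint hW hA (halive s₀ hs₀)) (hne.image _)).1
  have hlow : ∀ k (q : ℝ≥0), q ≤ t → min (m s₀) 1 ≤ clipDist a W k q ω := by
    intro k q hq
    have hq' : q ∈ Icc (0 : ℝ≥0) t := ⟨bot_le, hq⟩
    have hlt : (q : WithTop ℝ≥0) < swallowingTime (W ω) (a k) := lt_swallowingTime_of_alive hA (halive q hq') (ha k)
    rw [clipDist, if_pos hlt]
    refine min_le_min ?_ le_rfl
    have hmem : map (W ω) q (a k) - W ω q ∈ slidHull (W ω) A q := mem_slidHull_iff.2 ⟨a k, ha k, rfl⟩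
    have h1 := infDist_le_dist_of_mem (x := (0 : ℂ)) hmem
    rw [dist_comm, dist_zero_right] at h1
    exact (hmin hq').trans h1
  exact lt_of_lt_of_le (lt_min hμ one_pos) (le_aliveFn a W ω hlow)

/-- **Not alive ⇒ `aliveFn = 0`**: if some `a* ∈ A` (possibly real) is swallowed at a time
`τ ≤ t`, then for every `ε > 0` some `ψ_{k,q}`, `q ∈ ℚ ∩ [0, t]`, is `< ε`: by the extension
criterion the flow of `a*` comes `ε/2`-close to the driver at some `s < τ`; the map `g_s` is
continuous at the alive point `a*` and the points `a_k` accumulate at `a*` inside the open set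
`(closedHull_s)ᶜ`; and the flow of such an `a_k` is continuous in time. [folklore] -/
theorem aliveFn_lt_of_not_disjoint {ω : Ω} (hW : Continuous (W ω)) (hW0 : W ω 0 = 0) (hA : IsStarHull A)
    (hdense : A ⊆ closure (range a)) (haH : ∀ k, 0 < (a k).im) (ht : ¬ Disjoint (closedHull (W ω) t) A)
    {ε : ℝ} (hε : 0 < ε) : aliveFn a W t ω < ε := by
  classical
  -- a swallowed point `z ∈ A`, swallowed at `τ ≤ t`, `0 < τ`
  obtain ⟨z, hzK, hzA⟩ := Set.not_disjoint_iff.1 ht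
  obtain ⟨hzim, hzT⟩ : 0 ≤ z.im ∧ swallowingTime (W ω) z ≤ (t : WithTop ℝ≥0) := hzK
  have hTtop : swallowingTime (W ω) z ≠ ⊤ := ne_top_of_le_ne_top (WithTop.coe_ne_top) hzT
  obtain ⟨τ, hτ⟩ := WithTop.ne_top_iff_exists.1 hTtop
  have hτ' : swallowingTime (W ω) z = τ := hτ.symm
  have hτt : τ ≤ t := by rw [hτ'] at hzT; exact_mod_cast hzT
  have hz0 : z ≠ W ω 0 := by
    rw [hW0]; intro h
    exact hA.zero_notMem (by rw [Complex.ofReal_zero] at h; rwa [← h])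
  have hτpos : 0 < τ := by
    have := swallowingTime_pos_holds hW hz0
    rw [hτ'] at this; exact_mod_cast this
  -- the maximal solution from `z` comes `ε/2`-close to the driver before `τ`
  obtain ⟨G, hG⟩ := exists_isSolution_swallowingTime_holds hW hz0
  rw [hτ'] at hG
  have hε2 : (0 : ℝ) < ε / 2 := by positivity
  obtain ⟨s, hs0, hsτ, hclose⟩ : ∃ s : ℝ, 0 ≤ s ∧ s < τ ∧ ‖G s - W ω s.toNNReal‖ < ε / 2 := by
    by_contra hcon
    push Not at hcon
    have := hG.coe_lt_swallowingTime_of_le_norm_sub hW hτpos (δ := ⟨ε / 2, hε2.le⟩) hε2 fun r hr0 hrτ ↦ hcon r hr0 hrτ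
    rw [hτ'] at this
    exact lt_irrefl _ this
  set s' : ℝ≥0 := s.toNNReal with hs'
  have hss' : (s' : ℝ) = s := Real.coe_toNNReal s hs0
  have hs'τ : s' < τ := by rw [← NNReal.coe_lt_coe, hss']; exact hsτ
  have hs't : s' < t := lt_of_lt_of_le hs'τ hτt
  have hs'T : (s' : WithTop ℝ≥0) < swallowingTime (W ω) z := by rw [hτ']; exact_mod_cast hs'τ
  have hmapz : map (W ω) s' z = G s := by rw [map_eq_of_isSolution hW hG (by exact_mod_cast hs'τ), hss']
  -- continuity of `g_{s'}` at `z`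
  have hcz := continuousAt_map hW hs'T
  rw [Metric.continuousAt_iff] at hcz
  obtain ⟨δ₁, hδ₁, hδ₁z⟩ := hcz (ε / 4) (by positivity)
  -- `z ∉ closedHull_{s'}`, an open condition
  have hzK' : z ∉ closedHull (W ω) s' := fun h ↦ by
    have : swallowingTime (W ω) z ≤ (s' : WithTop ℝ≥0) := h.2
    exact (not_le.2 hs'T) this
  obtain ⟨δ₂, hδ₂, hball⟩ := Metric.isOpen_iff.1 (isClosed_closedHull hW s').isOpen_compl z hzK'
  -- a point `a k` close to `z`
  obtain ⟨_, ⟨k, rfl⟩, hk⟩ := Metric.mem_closure_iff.1 (hdense hzA) (min δ₁ δ₂) (lt_min hδ₁ hδ₂)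
  have hk1 : dist (a k) z < δ₁ := by rw [dist_comm]; exact lt_of_lt_of_le hk (min_le_left _ _)
  have hk2 : a k ∉ closedHull (W ω) s' := hball (mem_ball.2 (by rw [dist_comm]; exact lt_of_lt_of_le hk (min_le_right _ _)))
  have hkT : (s' : WithTop ℝ≥0) < swallowingTime (W ω) (a k) := by
    by_contra h
    exact hk2 ⟨(haH k).le, not_lt.1 h⟩
  have hbound_s' : ‖map (W ω) s' (a k) - W ω s'‖ < 3 * ε / 4 := by
    have h1 : dist (map (W ω) s' (a k)) (map (W ω) s' z) < ε / 4 := hδ₁z hk1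
    rw [dist_eq_norm] at h1
    have h2 : ‖map (W ω) s' z - W ω s'‖ < ε / 2 := by
      rw [hmapz]
      have : ((W ω s' : ℝ) : ℂ) = W ω s.toNNReal := by rw [hs']
      rw [this]; exact hclose
    calc ‖map (W ω) s' (a k) - W ω s'‖ = ‖(map (W ω) s' (a k) - map (W ω) s' z) + (map (W ω) s' z - W ω s')‖ := by ring_nf
      _ ≤ ‖map (W ω) s' (a k) - map (W ω) s' z‖ + ‖map (W ω) s' z - W ω s'‖ := norm_add_le _ _
      _ < 3 * ε / 4 := by linarith
  -- continuity in time of the flow of `a k` at `s'`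
  have hk0 : a k ≠ W ω 0 := ne_driving_of_lt_swallowingTime hkT
  obtain ⟨Gk, hGk⟩ := exists_isSolution_swallowingTime_holds hW hk0
  have hdom : s ∈ {r : ℝ | 0 ≤ r ∧ (r.toNNReal : WithTop ℝ≥0) < swallowingTime (W ω) (a k)} := ⟨hs0, hkT⟩
  have hcontk : ContinuousWithinAt (fun r : ℝ ↦ Gk r - W ω r.toNNReal)
      {r : ℝ | 0 ≤ r ∧ (r.toNNReal : WithTop ℝ≥0) < swallowingTime (W ω) (a k)} s :=
    (hGk.continuousOn s hdom).sub ((Complex.continuous_ofReal.comp (hW.comp continuous_real_toNNReal)).continuousWithinAt)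
  rw [Metric.continuousWithinAt_iff] at hcontk
  obtain ⟨δ₃, hδ₃, hδ₃s⟩ := hcontk (ε / 8) (by positivity)
  -- room before `T_{a k}` and before `t`
  obtain ⟨δ₄, hδ₄, hδ₄T⟩ : ∃ δ₄ : ℝ, 0 < δ₄ ∧ ∀ r : ℝ, s ≤ r → r < s + δ₄ →
      (r.toNNReal : WithTop ℝ≥0) < swallowingTime (W ω) (a k) := by
    rcases eq_or_ne (swallowingTime (W ω) (a k)) ⊤ with htop | hnt
    · exact ⟨1, one_pos, fun r _ _ ↦ by rw [htop]; exact WithTop.coe_lt_top _⟩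
    · obtain ⟨σ, hσ⟩ := WithTop.ne_top_iff_exists.1 hnt
      have hsσ : s < σ := by
        have : (s' : WithTop ℝ≥0) < σ := by rw [hσ]; exact hkT
        have h' : s' < σ := by exact_mod_cast this
        rw [← NNReal.coe_lt_coe, hss'] at h'; exact h'
      refine ⟨(σ - s) / 2, by linarith, fun r hr1 hr2 ↦ ?_⟩
      rw [← hσ, WithTop.coe_lt_coe, ← NNReal.coe_lt_coe, Real.coe_toNNReal r (hs0.trans hr1)]
      linarith
  set δ : ℝ := min δ₃ (min δ₄ ((t : ℝ) - s)) with hδ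
  have hδ0 : 0 < δ := by
    refine lt_min hδ₃ (lt_min hδ₄ ?_)
    have : (s' : ℝ) < t := by exact_mod_cast hs't
    rw [hss'] at this; linarith
  obtain ⟨q, hsq, hqs⟩ := exists_rat_btwn (show s < s + δ by linarith)
  have hq0 : 0 ≤ (q : ℝ) := hs0.trans hsq.le
  have hqt : (q : ℝ) ≤ t := by
    have := min_le_right δ₄ ((t : ℝ) - s)
    have := min_le_right δ₃ (min δ₄ ((t : ℝ) - s))
    linarith
  have hqT : ((q : ℝ).toNNReal : WithTop ℝ≥0) < swallowingTime (W ω) (a k) :=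
    hδ₄T q hsq.le (by have := min_le_left δ₄ ((t:ℝ) - s); have := min_le_right δ₃ (min δ₄ ((t : ℝ) - s)); linarith)
  have hqdist : dist (q : ℝ) s < δ₃ := by
    rw [Real.dist_eq, abs_of_pos (by linarith)]
    have := min_le_left δ₃ (min δ₄ ((t : ℝ) - s)); linarith
  have hnear := hδ₃s ⟨hq0, hqT⟩ hqdist
  rw [dist_eq_norm] at hnear
  -- the clipped distance at `(k, q)` is `< ε`
  set q' : ratTimes t := ⟨q, hq0, hqt⟩ with hq'
  have hqval : (q'.val : ℝ≥0) = (q : ℝ).toNNReal := by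
    apply NNReal.eq; rw [Real.coe_toNNReal _ hq0]; rfl
  have hmapk : map (W ω) q'.val (a k) = Gk q := by
    rw [hqval, map_eq_of_isSolution hW hGk hqT, Real.coe_toNNReal _ hq0]
  have hmaps : map (W ω) s' (a k) = Gk s := by
    rw [map_eq_of_isSolution hW hGk (by rw [hs']; exact hkT), hss']
  have hlt : (q'.val : WithTop ℝ≥0) < swallowingTime (W ω) (a k) := by rw [hqval]; exact hqT
  have hclip : clipDist a W k q'.val ω < ε := by
    rw [clipDist, if_pos hlt]
    refine lt_of_le_of_lt (min_le_left _ _) ?_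
    have hWq : ((W ω q'.val : ℝ) : ℂ) = W ω (q : ℝ).toNNReal := by rw [hqval]
    rw [hmapk, hWq]
    have hWs : ((W ω s' : ℝ) : ℂ) = W ω s.toNNReal := by rw [hs']
    rw [hmaps, hWs] at hbound_s'
    calc ‖Gk q - W ω (q : ℝ).toNNReal‖ = ‖(Gk q - W ω (q : ℝ).toNNReal - (Gk s - W ω s.toNNReal)) + (Gk s - W ω s.toNNReal)‖ := by
          ring_nf
      _ ≤ ‖Gk q - W ω (q : ℝ).toNNReal - (Gk s - W ω s.toNNReal)‖ + ‖Gk s - W ω s.toNNReal‖ := norm_add_le _ _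
      _ < ε := by linarith
  exact lt_of_le_of_lt (aliveFn_le_clipDist_rat a W ω k q') hclip

/-- **The alive event is `{0 < aliveFn}`.** [cite: LawlerSchrammWerner2003Restriction, §5 (t < T_A)] -/
theorem disjoint_closedHull_iff_aliveFn_pos {ω : Ω} (hW : Continuous (W ω)) (hW0 : W ω 0 = 0) (hA : IsStarHull A)
    (hne : A.Nonempty) (ha : ∀ k, a k ∈ A ∧ 0 < (a k).im) (hdense : A ⊆ closure (range a)) :
    Disjoint (closedHull (W ω) t) A ↔ 0 < aliveFn a W t ω := by
  refine ⟨fun h ↦ aliveFn_pos_of_disjoint hW hA hne (fun k ↦ (ha k).1) h, fun h ↦ ?_⟩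
  by_contra hnot
  exact lt_irrefl _ (aliveFn_lt_of_not_disjoint hW hW0 hA hdense (fun k ↦ (ha k).2) hnot h)

end AliveIff

/-! ### Measurability of the alive event -/

section AliveMeasurable

variable {Ω : Type*} {mΩ : MeasurableSpace Ω} {W : Ω → ℝ≥0 → ℝ} {A : Set ℂ} {t : ℝ≥0}

/-- **The alive event `{ω | closedHull_t(W ω) ∩ A = ∅}` is measurable** with respect to any
σ-algebra making the path values at times `≤ t` measurable (continuous paths from `0`, `A` a
nonempty `*`-hull). [cite: LawlerSchrammWerner2003Restriction, §5 (T_A)] -/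
theorem measurableSet_disjoint_closedHull (hc : ∀ ω, Continuous (W ω)) (hW0 : ∀ ω, W ω 0 = 0)
    (hmeas : ∀ s, s ≤ t → Measurable fun ω ↦ W ω s) (hA : IsStarHull A) (hne : A.Nonempty) :
    MeasurableSet {ω | Disjoint (closedHull (W ω) t) A} := by
  obtain ⟨a, ha, hdense⟩ := exists_denseSeq hA hne
  have : {ω | Disjoint (closedHull (W ω) t) A} = {ω | 0 < aliveFn a W t ω} := by
    ext ω; exact disjoint_closedHull_iff_aliveFn_pos (hc ω) (hW0 ω) hA hne ha hdense
  rw [this]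
  exact measurableSet_lt measurable_const (measurable_aliveFn hc hmeas fun k ↦ (ha k).2)

end AliveMeasurable

end Loewner

end Literature.Probability.RandomPlanarGeometry
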